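import Summits.CriticalPhenomena.SAWScalingLimit.Theses.SAWTensorRG
import Summits.CriticalPhenomena.SAWScalingLimit.Theorems.SAWConePseudogroupLatticeSimilarityOfLimitTransport
import HarnessLib

/-!
# Approximation independence of critical-SAW avoidance limits (crux `ConformalAvoidance`,
# route `SAWTensorRG`, line `birth`, stub `stub_approxIndependentLimits`;
# item stmt-CriticalPhenomena-7605)

Existence of the full-filter hull-avoidance limit for EVERY endpoint approximation implies that
the limit does not depend on the endpoint approximation: for a hull-subdomain pair `D ⊇ D'` of
Dobrushin domains and two endpoint approximations `(a, b)`, `(c, d)` of `D` whose critical-SAW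
avoidance probabilities `P_δ(range γ ⊆ closure D')` converge along `δ → 0+` to `r₁`, `r₂`
respectively, `r₁ = r₂`.

Proof (interleaving; a subsequence / uniqueness-of-limits argument). Let
`S = {1/(n+2) : n ∈ ℕ}` and splice a third pair `(e, f)` equal to `(a, b)` at the meshes `δ ∈ S`
and to `(c, d)` elsewhere. It is an endpoint approximation of `D` (reachability and convergence
of the mesh points are checked branch by branch, `Filter.Tendsto.if'`), so by the hypothesis its
avoidance probabilities converge along `𝓝[>] 0` to some `r₃`. Along `uₙ = 1/(n+2) ∈ S` (which
tends to `0` from the right) the avoidance probabilities of `(e, f)` and of `(a, b)` coincide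
term by term (substitution of equal endpoints under the dependent type `SAW.DomainSAW Ω δ a b`:
`map_curve_law_congr` of `SAWConePseudogroupLatticeSimilarityOfLimitTransport.lean`), whence
`r₃ = r₁` by uniqueness of limits in the Hausdorff space `ℝ≥0∞` (`tendsto_nhds_unique` along
`atTop`); along `vₙ = 1/(n + 5/2) ∉ S` (parity) they coincide with
those of `(c, d)`, whence `r₃ = r₂`. All [folklore]; context: Lawler–Schramm–Werner 2004,
*On the scaling limit of planar self-avoiding walk*, §3.4.2 (the limit should not depend on the
lattice approximation of the marked points).
-/

noncomputable section

open scoped Topology ENNReal NNReal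
open Filter Set MeasureTheory
open Literature.Probability.RandomPlanarGeometry Literature.Probability.LatticeModels

namespace Summit.CriticalPhenomena.SAWScalingLimit.Theorems.ConformalAvoidance

/-- The meshes `1/(n + C)`, `C > 0`, tend to `0` from the right as `n → ∞`. [folklore] -/
private theorem tendsto_one_div_natCast_add_nhdsGT {C : ℝ} (hC : 0 < C) :
    Tendsto (fun n : ℕ => (1 : ℝ) / ((n : ℝ) + C)) atTop (𝓝[>] (0 : ℝ)) := by
  refine tendsto_nhdsWithin_iff.2 ⟨?_, Eventually.of_forall fun n => ?_⟩
  · exact tendsto_const_nhds.div_atTop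
      (tendsto_atTop_add_const_right _ _ tendsto_natCast_atTop_atTop)
  · exact div_pos one_pos (add_pos_of_nonneg_of_pos (Nat.cast_nonneg n) hC)

/-- Parity: `1/(m+2) ≠ 1/(n + 5/2)` for naturals `m, n` (else `2n + 5 = 2m + 4`). [folklore] -/
private theorem one_div_natCast_add_two_ne_add_five_halves (m n : ℕ) :
    (1 : ℝ) / ((m : ℝ) + 2) ≠ 1 / ((n : ℝ) + 5 / 2) := by
  intro h
  rw [div_eq_div_iff (by positivity) (by positivity)] at h
  have h' : ((2 * n + 5 : ℕ) : ℝ) = ((2 * m + 4 : ℕ) : ℝ) := by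
    push_cast
    linarith
  have h'' : 2 * n + 5 = 2 * m + 4 := Nat.cast_injective h'
  omega

/-- **Approximation independence of the hull-avoidance limits** (registered stub
`stub_approxIndependentLimits` of line `birth`, crux `ConformalAvoidance`): if the avoidance limit
exists along `δ → 0+` for EVERY endpoint approximation of every hull pair, then two endpoint
approximations `(a, b)`, `(c, d)` of the same hull pair `(D, D')` have equal limits. Interleave
`(a, b)` (at the meshes `1/(n+2)`) with `(c, d)` (elsewhere); the interleaved pair is an endpoint
approximation, its limit `r₃` exists by the hypothesis, and `r₃ = r₁`, `r₃ = r₂` by uniqueness of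
limits along the sequences `1/(n+2)` and `1/(n+5/2)`. [folklore] -/
theorem stub_approxIndependentLimits :
    (∀ (D D' : DobrushinDomain) (a b : ℝ → Site 2), SAW.IsEndpointApprox D a b →
      D'.carrier ⊆ D.carrier → D'.pt 0 = D.pt 0 → D'.pt 1 = D.pt 1 →
      (∃ ε : ℝ, 0 < ε ∧ D'.carrier ∩ Metric.ball (D.pt 0) ε = D.carrier ∩ Metric.ball (D.pt 0) ε ∧
        D'.carrier ∩ Metric.ball (D.pt 1) ε = D.carrier ∩ Metric.ball (D.pt 1) ε) →
      ∃ r : ENNReal,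
        Tendsto (fun δ => ((SAW.law D.carrier δ (a δ) (b δ)).map (fun γ => γ.curve))
            (CurveClass.rangeSubset (closure D'.carrier))) (𝓝[>] 0) (𝓝 r)) →
    ∀ (D D' : DobrushinDomain) (a b c d : ℝ → Site 2),
      SAW.IsEndpointApprox D a b → SAW.IsEndpointApprox D c d →
      D'.carrier ⊆ D.carrier → D'.pt 0 = D.pt 0 → D'.pt 1 = D.pt 1 →
      (∃ ε : ℝ, 0 < ε ∧ D'.carrier ∩ Metric.ball (D.pt 0) ε = D.carrier ∩ Metric.ball (D.pt 0) ε ∧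
        D'.carrier ∩ Metric.ball (D.pt 1) ε = D.carrier ∩ Metric.ball (D.pt 1) ε) →
      ∀ r₁ r₂ : ENNReal,
        Tendsto (fun δ => ((SAW.law D.carrier δ (a δ) (b δ)).map (fun γ => γ.curve))
            (CurveClass.rangeSubset (closure D'.carrier))) (𝓝[>] 0) (𝓝 r₁) →
        Tendsto (fun δ => ((SAW.law D.carrier δ (c δ) (d δ)).map (fun γ => γ.curve))
            (CurveClass.rangeSubset (closure D'.carrier))) (𝓝[>] 0) (𝓝 r₂) → r₁ = r₂ := by
  classical
  intro hALE D D' a b c d hab hcd hsub h0 h1 hball r₁ r₂ hr₁ hr₂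
  -- the set of meshes at which the interleaved approximation follows `(a, b)`
  obtain ⟨S, hS⟩ : ∃ S : Set ℝ, S = Set.range (fun n : ℕ => (1 : ℝ) / ((n : ℝ) + 2)) := ⟨_, rfl⟩
  -- the interleaved pair is an endpoint approximation of `D`
  have hef : SAW.IsEndpointApprox D (fun δ => if δ ∈ S then a δ else c δ)
      (fun δ => if δ ∈ S then b δ else d δ) := by
    refine ⟨?_, ?_, ?_⟩
    · filter_upwards [hab.reachable, hcd.reachable] with δ ha hc
      show (discreteDomainGraph D.carrier δ).Reachable (if δ ∈ S then a δ else c δ)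
        (if δ ∈ S then b δ else d δ)
      split_ifs
      exacts [ha, hc]
    · have key : (fun δ => meshPoint δ (if δ ∈ S then a δ else c δ)) =
          fun δ => if δ ∈ S then meshPoint δ (a δ) else meshPoint δ (c δ) := by
        funext δ
        split_ifs <;> rfl
      show Tendsto (fun δ => meshPoint δ (if δ ∈ S then a δ else c δ)) (𝓝[>] 0) (𝓝 (D.pt 0))
      rw [key]
      exact hab.tendsto_fst.if' hcd.tendsto_fst
    · have key : (fun δ => meshPoint δ (if δ ∈ S then b δ else d δ)) =
          fun δ => if δ ∈ S then meshPoint δ (b δ) else meshPoint δ (d δ) := by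
        funext δ
        split_ifs <;> rfl
      show Tendsto (fun δ => meshPoint δ (if δ ∈ S then b δ else d δ)) (𝓝[>] 0) (𝓝 (D.pt 1))
      rw [key]
      exact hab.tendsto_snd.if' hcd.tendsto_snd
  -- its avoidance limit exists by the hypothesis
  obtain ⟨r₃, hr₃⟩ := hALE D D' _ _ hef hsub h0 h1 hball
  -- two sequences of meshes tending to `0⁺`, inside and outside `S`
  have hu : Tendsto (fun n : ℕ => (1 : ℝ) / ((n : ℝ) + 2)) atTop (𝓝[>] (0 : ℝ)) :=
    tendsto_one_div_natCast_add_nhdsGT two_pos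
  have hv : Tendsto (fun n : ℕ => (1 : ℝ) / ((n : ℝ) + 5 / 2)) atTop (𝓝[>] (0 : ℝ)) :=
    tendsto_one_div_natCast_add_nhdsGT (by norm_num)
  have huS : ∀ n : ℕ, (1 : ℝ) / ((n : ℝ) + 2) ∈ S := fun n => by
    rw [hS]
    exact ⟨n, rfl⟩
  have hvS : ∀ n : ℕ, (1 : ℝ) / ((n : ℝ) + 5 / 2) ∉ S := fun n hn => by
    rw [hS] at hn
    obtain ⟨m, hm⟩ := hn
    exact one_div_natCast_add_two_ne_add_five_halves m n hm
  -- along `u` the interleaved avoidance probabilities are those of `(a, b)`: `r₁ = r₃`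
  have h₁₃ : r₁ = r₃ := by
    refine tendsto_nhds_unique (hr₁.comp hu) ((hr₃.comp hu).congr fun n => ?_)
    exact congrArg
      (fun μ : Measure (CurveClass ℂ) => μ (CurveClass.rangeSubset (closure D'.carrier)))
      (LatticeSimilarityOfLimit.map_curve_law_congr (if_pos (huS n)) (if_pos (huS n)))
  -- along `v` they are those of `(c, d)`: `r₂ = r₃`
  have h₂₃ : r₂ = r₃ := by
    refine tendsto_nhds_unique (hr₂.comp hv) ((hr₃.comp hv).congr fun n => ?_)
    exact congrArg
      (fun μ : Measure (CurveClass ℂ) => μ (CurveClass.rangeSubset (closure D'.carrier)))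
      (LatticeSimilarityOfLimit.map_curve_law_congr (if_neg (hvS n)) (if_neg (hvS n)))
  exact h₁₃.trans h₂₃.symm

end Summit.CriticalPhenomena.SAWScalingLimit.Theorems.ConformalAvoidance

end
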